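import Literature.NumberTheory.Sieve.LinearEquationsInPrimesKvNDecomposition
import Literature.NumberTheory.Sieve.LinearEquationsInPrimesGowersUniformity
import HarnessLib

/-!
# The relative inverse Gowers-norm theorem (Green–Tao 2010, Prop. 10.1) from `GI(s)`

Trunk T-SIEVE (`Literature/NumberTheory/Sieve`). Part of the decomposition of
`Literature.NumberTheory.Sieve.GreenTao2010_gowersUniformity` (B. Green, T. Tao, *Linear equations
in primes*, Ann. of Math. 171 (2010), Thm. 7.2). The tree already reduces Thm. 7.2 to Props. 10.1
and 10.2 (`Literature.NumberTheory.Sieve.GreenTao2010_gowersUniformity_of_relativeInverse_of_orthogonality`,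
with Prop. 6.4 proved). This file proves **Proposition 10.1** — the predicate
`Literature.NumberTheory.Sieve.GreenTao2010_relativeInverseAt s δ C A` — from the two
nilsequence-side statements it rests on in the source, both rendered here as predicates of their
parameters (not asserted, cf. the debt discipline of `LinearEquationsInPrimesNilsequences.lean`):

* `Literature.NumberTheory.Sieve.GreenTao2010_inverseConjectureAt s δ` — the inverse conjecture
  `GI(s)` for the `U^{s+1}[N]` norm, Conj. 8.3 as printed (now Green–Tao–Ziegler 2012, Thm. 1.3);
* `Literature.NumberTheory.Sieve.GreenTao2010_nilObstructionAt s X M` — "nilsequences obstruct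
  uniformity, II", Cor. 11.6 as printed (proved in the source from Prop. 11.2 and App. E).

Main results (all proved):

* `Literature.NumberTheory.Sieve.GreenTao2010_relativeInverseDatum_of_inverseDatum` /
  `GreenTao2010_relativeInverseAt_of_datum` / `GreenTao2010_relativeInverseAt_of` — **Prop. 10.1
  from `GI(s)` and Cor. 11.6** (the datum forms need Cor. 11.6 only for the members of the `GI(s)`
  family, `GreenTao2010_inverseDatum`, and output the same family and Lipschitz bound,
  `GreenTao2010_relativeInverseDatum`), following the printed proof of §10: Lemma B.5 (both halves:
  `Literature.NumberTheory.Sieve.gowersPower_extendByZero_eq`, the cube count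
  `card_gowersCubeParams_ge`, `uniformityNorm_pow_le_gowersPower_extendByZero`, and the sibling's
  `gowersPower_extendByZero_le`), the Koopman–von Neumann decomposition with the support property
  (`Literature.NumberTheory.Sieve.gowers_denseModel` and the taper of `[N]`,
  `LinearEquationsInPrimesKvNDecomposition.lean` — Prop. 10.3, proved), the triangle inequality for
  `‖·‖_{U^{s+1}(ℤ_{N'})}` (`gowersNorm_add_le`, from the cube Gowers–Cauchy–Schwarz inequality),
  unwrapping to `[1, 5N-4]` (`unwrap`, `extendByZero_unwrap`), `GI(s)`, Cor. 11.6 for the uniform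
  part, and the re-indexing back to `[N]` (`orbitAverage_unwrap_shift`);
* `Literature.NumberTheory.Sieve.GreenTao2010_gowersUniformity_of_conjectures` — consequently
  **Thm. 7.2 (all `s`) follows from `GI(s)`, Cor. 11.6 and Prop. 10.2** at every level `s ≥ 1`,
  and so does the Green–Tao–Ziegler theorem
  (`GreenTaoZiegler2012_finiteComplexity_of_conjectures`). What remains between
  `GreenTao2010_gowersUniformity` and the literature is thus exactly: `GI(s)` (GTZ 2012), Cor. 11.6
  and Prop. 10.2 (§§11–12 of the source with `MN(s)`, Green–Tao 2012) — all statements about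
  nilsequences.

## Rendering notes

* Where the source writes "from (10.4) and the contrapositive of Proposition 8.2 we have
  `|𝔼 f₂(n)F(gⁿx)| = o(1)`", Prop. 8.2 (nilsequences obstruct uniformity, for `f : [N] → [-1,1]`)
  does not literally apply to the unbounded `f₂`; the `L¹` version Cor. 11.6 ("Although we will
  not need this fact here …") is what is used, with `𝔼|f₂| = O_C(1)` (`l1_bound_shift_unwrap`).
* The support property of Prop. 10.3 is obtained with the taper of
  `LinearEquationsInPrimesKvNDecomposition.lean` instead of a de la Vallée Poussin kernel (the
  tree's Gowers norms are real-valued), with supports `[N] ⊆ [3-2N, 3N-2]` in place of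
  `{-N,…,N} ⊆ {-2N,…,2N}`; `C ≥ 20` again guarantees that no wrap-around occurs (`2(5N-4) ≤ N'`).
* The predicate `GreenTao2010_relativeInverseAt` carries a threshold `N₀`; we take `N₀ = 1`, so
  the remark of the source on `N = O_{s,δ,C}(1)` (all functions on `[N]` are nilsequences on the
  torus) is not needed. Constants: `C_B = 2(2(s+1))^{s+1}(2C)^{s+2}`, `GI(s)` is invoked at
  `δ/(2C_B)`, Cor. 11.6 at `min(c_{GI}/(2(4C+1)), 1/2)`, and the dense-model accuracy is
  `min((δ/2C_B)^{2^{s+1}}, (c_{min}(4C+1))^{2^{s+1}}/(2C_B))`.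

## References

* B. Green, T. Tao, *Linear equations in primes*, Ann. of Math. (2) 171 (2010), 1753–1850
  (arXiv:math/0606088): Prop. 10.1 and its proof (§10), Prop. 10.3, Conj. 8.3, Prop. 8.2,
  Cor. 11.6, App. B (Lemma B.5). [cite: GreenTao2010, §10]
* B. Green, T. Tao, T. Ziegler, *An inverse theorem for the Gowers `U^{s+1}[N]`-norm*, Ann. of
  Math. (2) 176 (2012), 1231–1372, Thm. 1.3. [cite: GreenTaoZiegler2012, Thm. 1.3]
-/

noncomputable section

open Finset
open scoped BigOperators

namespace Literature.NumberTheory.Sieve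

/-! ### The cyclic Gowers norm: homogeneity, triangle inequality, translation invariance -/

section cyclicnorm

variable {M : ℕ} [NeZero M]

/-- The cyclic Gowers norm `‖g‖_{U^k(ℤ_M)} = (‖g‖_{U^k}^{2^k})^{1/2^k}`. [cite: GreenTao2010, App. B] -/
def gowersNorm (k : ℕ) (g : ZMod M → ℝ) : ℝ :=
  gowersPower k g ^ ((2 ^ k : ℕ) : ℝ)⁻¹

/-- `‖g‖_{U^k} ≥ 0` (`k ≥ 1`). [cite: GreenTao2010, App. B] -/
theorem gowersNorm_nonneg {k : ℕ} (hk : 1 ≤ k) (g : ZMod M → ℝ) : 0 ≤ gowersNorm k g :=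
  Real.rpow_nonneg (gowersPower_nonneg hk g) _

/-- `‖g‖_{U^k}^{2^k}` recovers the Gowers power. [folklore] -/
theorem gowersNorm_pow {k : ℕ} (hk : 1 ≤ k) (g : ZMod M → ℝ) :
    gowersNorm k g ^ (2 ^ k) = gowersPower k g :=
  Real.rpow_inv_natCast_pow (gowersPower_nonneg hk g) (by positivity)

omit [NeZero M] in
/-- Homogeneity of the cube product. [folklore] -/
theorem gowersProd_const_mul (k : ℕ) (c : ℝ) (g : ZMod M → ℝ) (x : ZMod M) (h : Fin k → ZMod M) :
    gowersProd k (fun y => c * g y) x h = c ^ (2 ^ k) * gowersProd k g x h := by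
  unfold gowersProd
  rw [Finset.prod_mul_distrib, Finset.prod_const, Finset.card_univ, Fintype.card_finset,
    Fintype.card_fin]

/-- Homogeneity of the Gowers power: `‖c g‖_{U^k}^{2^k} = c^{2^k} ‖g‖_{U^k}^{2^k}`. [folklore] -/
theorem gowersPower_const_mul (k : ℕ) (c : ℝ) (g : ZMod M → ℝ) :
    gowersPower k (fun y => c * g y) = c ^ (2 ^ k) * gowersPower k g := by
  unfold gowersPower
  simp_rw [gowersProd_const_mul]
  exact (Finset.mul_expect _ _ _).symm

/-- Homogeneity of the Gowers norm: `‖c g‖_{U^k} = c ‖g‖_{U^k}` for `c ≥ 0`. [folklore] -/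
theorem gowersNorm_const_mul {k : ℕ} (hk : 1 ≤ k) {c : ℝ} (hc : 0 ≤ c) (g : ZMod M → ℝ) :
    gowersNorm k (fun y => c * g y) = c * gowersNorm k g := by
  unfold gowersNorm
  rw [gowersPower_const_mul, Real.mul_rpow (pow_nonneg hc _) (gowersPower_nonneg hk g),
    Real.pow_rpow_inv_natCast hc (by positivity)]

/-- `‖-g‖_{U^k} = ‖g‖_{U^k}` (`k ≥ 1`: an even number of factors). [folklore] -/
theorem gowersPower_neg {k : ℕ} (hk : 1 ≤ k) (g : ZMod M → ℝ) :
    gowersPower k (fun y => -g y) = gowersPower k g := by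
  have h : (fun y => -g y) = fun y => (-1 : ℝ) * g y := by funext y; ring
  rw [h, gowersPower_const_mul]
  have heven : Even (2 ^ k) := Nat.even_pow.mpr ⟨even_two, by omega⟩
  rw [heven.neg_one_pow, one_mul]

/-- **The triangle inequality for `‖·‖_{U^k(ℤ_M)}`** (`k ≥ 1`): expand `∏_ω (f + g)(x + ω·h)` over
the subsets `S` of the vertices, bound each Gowers inner product by Gowers–Cauchy–Schwarz, and
resum: `‖f + g‖^{2^k} ≤ ∑_S ‖f‖^{|S|} ‖g‖^{2^k - |S|} = (‖f‖ + ‖g‖)^{2^k}`.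
[cite: GreenTao2010, App. B (the `U^{s+1}` norms are norms, via Lemma B.2)] -/
theorem gowersNorm_add_le {k : ℕ} (hk : 1 ≤ k) (f g : ZMod M → ℝ) :
    gowersNorm k (fun y => f y + g y) ≤ gowersNorm k f + gowersNorm k g := by
  set a := gowersNorm k f with ha
  set b := gowersNorm k g with hb
  have ha0 : 0 ≤ a := gowersNorm_nonneg hk f
  have hb0 : 0 ≤ b := gowersNorm_nonneg hk g
  -- the families `F_S`
  set FS : Finset (Finset (Fin k)) → Finset (Fin k) → ZMod M → ℝ :=
    fun S ω => if ω ∈ S then f else g with hFS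
  have hexp : gowersPower k (fun y => f y + g y) =
      ∑ S : Finset (Finset (Fin k)), gowersInner k (FS S) := by
    unfold gowersPower gowersInner
    rw [← Finset.expect_sum_comm]
    refine Finset.expect_congr rfl fun p _ => ?_
    unfold gowersProd cubeProd
    rw [Fintype.prod_add]
    refine Fintype.sum_congr _ _ fun S => ?_
    rw [hFS]
    dsimp only
    simp_rw [ite_apply]
    rw [Finset.prod_ite, Finset.filter_mem_eq_inter, Finset.univ_inter]
    congr 1
    refine Finset.prod_congr ?_ fun ω _ => rfl
    ext ω; simp [Finset.mem_compl]
  have hbound : ∀ S : Finset (Finset (Fin k)), |gowersInner k (FS S)| ≤ a ^ S.card * b ^ Sᶜ.card := by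
    intro S
    refine (abs_gowersInner_le hk (FS S)).trans (le_of_eq ?_)
    have : ∀ ω : Finset (Fin k), gowersPower k (FS S ω) ^ ((2 ^ k : ℕ) : ℝ)⁻¹ =
        if ω ∈ S then a else b := by
      intro ω
      rw [hFS]; dsimp only
      split_ifs <;> rfl
    simp_rw [this]
    have hfilt : (Finset.univ : Finset (Finset (Fin k))).filter (fun ω => ¬ ω ∈ S) = Sᶜ := by
      ext ω; simp [Finset.mem_compl]
    rw [Finset.prod_ite, Finset.filter_mem_eq_inter, Finset.univ_inter, hfilt, Finset.prod_const,
      Finset.prod_const]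
  have hpow : gowersPower k (fun y => f y + g y) ≤ (a + b) ^ (2 ^ k) := by
    rw [hexp]
    calc ∑ S : Finset (Finset (Fin k)), gowersInner k (FS S)
        ≤ ∑ S : Finset (Finset (Fin k)), a ^ S.card * b ^ Sᶜ.card :=
          Finset.sum_le_sum fun S _ => (le_abs_self _).trans (hbound S)
      _ = ∏ _ω : Finset (Fin k), (a + b) := by
          rw [Fintype.prod_add]
          simp_rw [Finset.prod_const]
      _ = (a + b) ^ (2 ^ k) := by
          rw [Finset.prod_const, Finset.card_univ, Fintype.card_finset, Fintype.card_fin]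
  unfold gowersNorm
  calc gowersPower k (fun y => f y + g y) ^ ((2 ^ k : ℕ) : ℝ)⁻¹
      ≤ ((a + b) ^ (2 ^ k)) ^ ((2 ^ k : ℕ) : ℝ)⁻¹ :=
        Real.rpow_le_rpow (gowersPower_nonneg hk _) hpow (by positivity)
    _ = a + b := Real.pow_rpow_inv_natCast (by positivity) (by positivity)

/-- `‖f‖ ≤ ‖f - g‖ + ‖g‖`-type consequence: `‖f‖_{U^k} ≤ ‖f + g‖_{U^k} + ‖g‖_{U^k}`. [folklore] -/
theorem gowersNorm_le_add {k : ℕ} (hk : 1 ≤ k) (f g : ZMod M → ℝ) :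
    gowersNorm k f ≤ gowersNorm k (fun y => f y + g y) + gowersNorm k g := by
  have h := gowersNorm_add_le hk (fun y => f y + g y) (fun y => -g y)
  have h1 : (fun y => f y + g y + -g y) = f := by funext y; ring
  rw [h1] at h
  unfold gowersNorm at h ⊢
  rwa [gowersPower_neg hk] at h

/-- Translation invariance: `‖g(· + t)‖_{U^k}^{2^k} = ‖g‖_{U^k}^{2^k}`. [folklore] -/
theorem gowersPower_comp_add (k : ℕ) (g : ZMod M → ℝ) (t : ZMod M) :
    gowersPower k (fun y => g (y + t)) = gowersPower k g := by
  unfold gowersPower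
  rw [expect_prod_eq, expect_prod_eq]
  refine (Finset.expect_comm _ _ _).trans ((Finset.expect_congr rfl fun h _ => ?_).trans
    (Finset.expect_comm _ _ _))
  have hpt : ∀ x : ZMod M, gowersProd k (fun y => g (y + t)) x h = gowersProd k g (x + t) h := by
    intro x
    unfold gowersProd
    refine Finset.prod_congr rfl fun ω _ => ?_
    rw [add_right_comm]
  simp_rw [hpt]
  exact expect_gowersProd_add k g t h

end cyclicnorm

/-! ### Comparison of `U^k(ℤ_{N'})` and `U^k[N]`: the identity of Lemma B.5 and the cube count -/

section compareB5

variable {N' : ℕ} [NeZero N']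

/-- **The identity behind Lemma B.5**: for `1 ≤ N`, `2N ≤ N'`,
`‖f 1_{[N]}‖_{U^k(ℤ_{N'})}^{2^k} = (#{cubes ⊆ [N]} / N'^{k+1}) · ‖f‖_{U^k[N]}^{2^k}` (the cubes of
`ℤ_{N'}` with all vertices in `[N]` are exactly the reductions of the cubes of `ℤ` in `[N]`).
[cite: GreenTao2010, App. B, Lemma B.5 and its proof] -/
theorem gowersPower_extendByZero_eq {k N : ℕ} (hk : 1 ≤ k) (hN1 : 1 ≤ N) (hN : 2 * N ≤ N')
    (f : ℤ → ℝ) :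
    gowersPower k (extendByZero N' N f) =
      ((gowersCubeParams k N).card / (N' : ℝ) ^ (k + 1)) *
        uniformityNorm k N (fun n => ((f n : ℝ) : ℂ)) ^ (2 ^ k) := by
  have hNN' : N < N' := by omega
  set P := gowersCubeParams k N with hP
  set T : ℤ × (Fin k → ℤ) → ℝ := fun p => ∏ ω : Finset (Fin k), f (cubeVertex p.1 p.2 ω) with hT
  set G : ZMod N' × (Fin k → ZMod N') → ℝ :=
    fun q => gowersProd k (extendByZero N' N f) q.1 q.2 with hG
  have hinj := reduceParams_injOn (k := k) (N' := N') hNN'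
  have hsum : ∑ q, G q = ∑ p ∈ P, T p := by
    classical
    rw [← Finset.sum_subset (Finset.subset_univ (P.image (reduceParams N')))]
    · rw [Finset.sum_image hinj]
      exact Finset.sum_congr rfl fun p hp => gowersProd_extendByZero_reduce hNN' f hp
    · intro q _ hq
      by_contra hne
      apply hq
      have hall : ∀ ω : Finset (Fin k), extendByZero N' N f (q.1 + ∑ j ∈ ω, q.2 j) ≠ 0 := by
        intro ω h0
        exact hne (Finset.prod_eq_zero (Finset.mem_univ ω) h0)
      obtain ⟨p, hp, hpq⟩ := exists_lift_of_vertices hN q fun ω => extendByZero_ne_zero (hall ω)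
      exact Finset.mem_image.mpr ⟨p, hp, hpq⟩
  have hcard : (Fintype.card (ZMod N' × (Fin k → ZMod N')) : ℝ) = (N' : ℝ) ^ (k + 1) := by
    rw [Fintype.card_prod, Fintype.card_pi, Finset.prod_const, Finset.card_univ, Fintype.card_fin,
      ZMod.card]
    push_cast
    ring
  have hcardpos : (0 : ℝ) < P.card := by exact_mod_cast (gowersCubeParams_nonempty k hN1).card_pos
  have hgp : gowersPower k (extendByZero N' N f) = (∑ p ∈ P, T p) / (N' : ℝ) ^ (k + 1) := by
    unfold gowersPower
    rw [Fintype.expect_eq_sum_div_card, hsum, hcard]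
  -- the sum over the cubes in `[N]` is non-negative
  have hsum0 : 0 ≤ ∑ p ∈ P, T p := by
    have h0 : 0 ≤ gowersPower k (extendByZero N' N f) := gowersPower_nonneg hk _
    rw [hgp] at h0
    exact (div_nonneg_iff.mp h0).elim (fun h => h.1) fun h => by
      have : (0 : ℝ) < (N' : ℝ) ^ (k + 1) := by
        have : (0 : ℝ) < N' := by exact_mod_cast Nat.pos_of_ne_zero (NeZero.ne N')
        positivity
      linarith [h.2]
  rw [hgp, uniformityNorm_pow_ofReal, abs_of_nonneg hsum0, ← hP, div_mul_div_comm,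
    mul_comm ((P.card : ℝ)) (∑ p ∈ P, T p), mul_div_mul_right _ _ hcardpos.ne']

/-- **The cube count**: `#{cubes ⊆ [N]} ≥ N^{k+1} / (2 (2k)^k)` for `k, N ≥ 1` (the cubes with base
point in `[1, N - k⌊N/2k⌋]` and steps in `[0, ⌊N/2k⌋]`). [cite: GreenTao2010, App. B, proof of
Lemma B.5 ("`|B| ≫ N^{s+2}`")] -/
theorem card_gowersCubeParams_ge {k N : ℕ} (hk : 1 ≤ k) (hN : 1 ≤ N) :
    (N : ℝ) ^ (k + 1) / (2 * (2 * k) ^ k) ≤ (gowersCubeParams k N).card := by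
  classical
  set b : ℕ := N / (2 * k) with hb
  have hkb : k * b ≤ N / 2 := by
    rw [hb]
    calc k * (N / (2 * k)) = k * (N / 2 / k) := by rw [Nat.div_div_eq_div_mul, mul_comm 2 k]
      _ ≤ N / 2 := Nat.mul_div_le (N / 2) k
  set a : ℕ := N - k * b with ha
  have haN : a + k * b = N := by omega
  have ha2 : N ≤ 2 * a := by omega
  -- the box of cubes
  set S : Finset (ℤ × (Fin k → ℤ)) :=
    (Finset.Icc (1 : ℤ) a) ×ˢ (Fintype.piFinset fun _ : Fin k => Finset.Icc (0 : ℤ) b) with hS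
  have hsub : S ⊆ gowersCubeParams k N := by
    intro p hp
    rw [hS, Finset.mem_product, Finset.mem_Icc, Fintype.mem_piFinset] at hp
    obtain ⟨⟨hx1, hxa⟩, hh⟩ := hp
    have hh' : ∀ j, 0 ≤ p.2 j ∧ p.2 j ≤ b := fun j => Finset.mem_Icc.mp (hh j)
    refine mem_gowersCubeParams.mpr fun ω => Finset.mem_Icc.mpr ⟨?_, ?_⟩
    · unfold cubeVertex
      have : 0 ≤ ∑ j ∈ ω, p.2 j := Finset.sum_nonneg fun j _ => (hh' j).1
      linarith
    · unfold cubeVertex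
      have h1 : ∑ j ∈ ω, p.2 j ≤ ∑ _j ∈ ω, (b : ℤ) := Finset.sum_le_sum fun j _ => (hh' j).2
      rw [Finset.sum_const, nsmul_eq_mul] at h1
      have h2 : (ω.card : ℤ) * b ≤ k * b := by
        have : ω.card ≤ k := (Finset.card_le_univ ω).trans (by rw [Fintype.card_fin])
        exact_mod_cast Nat.mul_le_mul_right b this
      have h3 : (a : ℤ) + k * b = N := by exact_mod_cast haN
      linarith
  have hcardS : S.card = a * (b + 1) ^ k := by
    rw [hS, Finset.card_product, Fintype.card_piFinset, Finset.prod_const, Finset.card_univ,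
      Fintype.card_fin, Int.card_Icc, Int.card_Icc]
    have h1 : ((a : ℤ) + 1 - 1).toNat = a := by simp
    have h2 : ((b : ℤ) + 1 - 0).toNat = b + 1 := by
      rw [sub_zero, show ((b : ℤ) + 1) = ((b + 1 : ℕ) : ℤ) by push_cast; rfl, Int.toNat_natCast]
    rw [h1, h2]
  have hle : (S.card : ℝ) ≤ (gowersCubeParams k N).card := by
    exact_mod_cast Finset.card_le_card hsub
  refine le_trans ?_ hle
  rw [hcardS]
  push_cast
  -- `N^{k+1}/(2 (2k)^k) ≤ a (b+1)^k` from `N ≤ 2a` and `N ≤ 2k(b+1)`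
  have hkpos : (0 : ℝ) < k := by exact_mod_cast hk
  have hb1 : (N : ℝ) ≤ 2 * k * (b + 1) := by
    have h1 : N < 2 * k * (N / (2 * k) + 1) := Nat.lt_mul_div_succ N (by omega)
    rw [← hb] at h1
    exact_mod_cast h1.le
  have ha2' : (N : ℝ) ≤ 2 * a := by exact_mod_cast ha2
  rw [div_le_iff₀ (by positivity)]
  calc (N : ℝ) ^ (k + 1) = N * N ^ k := by ring
    _ ≤ (2 * a) * (2 * k * (b + 1)) ^ k := by
        gcongr
    _ = a * (b + 1) ^ k * (2 * (2 * k) ^ k) := by simp only [mul_pow]; ring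

/-- **The lower half of Lemma B.5**: for `1 ≤ k`, `1 ≤ N`, `2N ≤ N'` and `N' ≤ C' N`,
`‖f‖_{U^k[N]}^{2^k} ≤ 2 (2k)^k C'^{k+1} ‖f 1_{[N]}‖_{U^k(ℤ_{N'})}^{2^k}`.
[cite: GreenTao2010, App. B, Lemma B.5] -/
theorem uniformityNorm_pow_le_gowersPower_extendByZero {k N : ℕ} (hk : 1 ≤ k) (hN1 : 1 ≤ N)
    (hN : 2 * N ≤ N') {C' : ℝ} (hC' : (N' : ℝ) ≤ C' * N) (f : ℤ → ℝ) :
    uniformityNorm k N (fun n => ((f n : ℝ) : ℂ)) ^ (2 ^ k) ≤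
      (2 * (2 * k) ^ k * C' ^ (k + 1)) * gowersPower k (extendByZero N' N f) := by
  have hNpos : (0 : ℝ) < N := by exact_mod_cast hN1
  have hN'pos : (0 : ℝ) < N' := by exact_mod_cast (show 0 < N' by omega)
  have hC'pos : 0 < C' := by
    by_contra h
    push Not at h
    nlinarith
  rw [gowersPower_extendByZero_eq hk hN1 hN f]
  set U := uniformityNorm k N (fun n => ((f n : ℝ) : ℂ)) ^ (2 ^ k) with hU
  have hU0 : 0 ≤ U := pow_nonneg (uniformityNorm_nonneg _ _ _) _
  have hcard := card_gowersCubeParams_ge hk hN1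
  -- `(#P / N'^{k+1}) ≥ 1 / (2 (2k)^k C'^{k+1})`
  have hratio : 1 / (2 * (2 * k) ^ k * C' ^ (k + 1)) ≤
      (gowersCubeParams k N).card / (N' : ℝ) ^ (k + 1) := by
    rw [div_le_div_iff₀ (by positivity) (by positivity), one_mul]
    calc (N' : ℝ) ^ (k + 1) ≤ (C' * N) ^ (k + 1) := by gcongr
      _ = (N : ℝ) ^ (k + 1) / (2 * (2 * k) ^ k) * (2 * (2 * k) ^ k * C' ^ (k + 1)) := by
          field_simp
          ring
      _ ≤ (gowersCubeParams k N).card * (2 * (2 * k) ^ k * C' ^ (k + 1)) :=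
          mul_le_mul_of_nonneg_right hcard (by positivity)
  calc U = (2 * (2 * k) ^ k * C' ^ (k + 1)) * (1 / (2 * (2 * k) ^ k * C' ^ (k + 1)) * U) := by
        field_simp
    _ ≤ (2 * (2 * k) ^ k * C' ^ (k + 1)) * ((gowersCubeParams k N).card / (N' : ℝ) ^ (k + 1) * U) :=
        mul_le_mul_of_nonneg_left (mul_le_mul_of_nonneg_right hratio hU0) (by positivity)

/-- Unwrapping a function on `ℤ_{N'}` to `[1, L] ⊆ ℤ`. [folklore] -/
def unwrap (N' L : ℕ) (F : ZMod N' → ℝ) (n : ℤ) : ℝ :=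
  if 1 ≤ n ∧ n ≤ L then F (n : ZMod N') else 0

omit [NeZero N'] in
/-- `unwrap` agrees with `F` on `[1, L]`. [folklore] -/
theorem unwrap_of_mem {L : ℕ} (F : ZMod N' → ℝ) {n : ℤ} (h1 : 1 ≤ n) (h2 : n ≤ L) :
    unwrap N' L F n = F (n : ZMod N') := by
  unfold unwrap; rw [if_pos ⟨h1, h2⟩]

omit [NeZero N'] in
/-- `unwrap` vanishes off `[1, L]`. [folklore] -/
theorem unwrap_of_not_mem {L : ℕ} (F : ZMod N' → ℝ) {n : ℤ} (h : ¬ (1 ≤ n ∧ n ≤ L)) :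
    unwrap N' L F n = 0 := by
  unfold unwrap; rw [if_neg h]

omit [NeZero N'] in
/-- `|unwrap F n| ≤ |F n|`. [folklore] -/
theorem abs_unwrap_le {L : ℕ} (F : ZMod N' → ℝ) (n : ℤ) : |unwrap N' L F n| ≤ |F (n : ZMod N')| := by
  unfold unwrap
  split_ifs
  · exact le_rfl
  · rw [abs_zero]; exact abs_nonneg _

/-- **A function on `ℤ_{N'}` supported on the image of `[1, L]`, `L < N'`, is the extension by zero
of its unwrapping** ("the interval … is Freiman isomorphic to its counterpart in `ℤ_{N'}`").
[cite: GreenTao2010, App. B, proof of Lemma B.5] -/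
theorem extendByZero_unwrap {L : ℕ} {F : ZMod N' → ℝ}
    (hF : ∀ y, F y ≠ 0 → 1 ≤ y.val ∧ y.val ≤ L) : extendByZero N' L (unwrap N' L F) = F := by
  funext y
  unfold extendByZero
  by_cases hy : 1 ≤ y.val ∧ y.val ≤ L
  · rw [if_pos hy, unwrap_of_mem F (by exact_mod_cast hy.1) (by exact_mod_cast hy.2),
      Int.cast_natCast, ZMod.natCast_zmod_val]
  · rw [if_neg hy]
    by_contra hne
    exact hy (hF y (Ne.symm hne))

end compareB5

end Literature.NumberTheory.Sieve

namespace Literature.NumberTheory.Sieve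

/-! ### The two conjectural inputs of Prop. 10.1, as predicates (not asserted) -/

/-- The conclusion of `GI(s)` at parameter `δ` for a given finite family `𝓜` of `s`-step
nilmanifolds, Lipschitz bound `M` and correlation bound `c`: every `1`-bounded `f : [N] → ℝ` with
`‖f‖_{U^{s+1}[N]} ≥ δ` correlates (`≥ c`) with a `1`-bounded nilsequence of Lipschitz constant
`≤ M` on some member of the family ("there is a nilmanifold `G/Γ ∈ ℳ_{s,δ}` and a `1`-bounded
`s`-step nilsequence `(F(gⁿx))_{n ∈ ℕ}` on it with Lipschitz constant `O_{s,δ}(1)`, such that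
`|𝔼_{n ∈ [N]} f(n) F(gⁿ x)| ≫_{s,δ} 1`"). `GI(s)` asserts the existence of such a datum
(`GreenTao2010_inverseConjectureAt`); isolating it lets Prop. 10.1 be stated with Cor. 11.6
required only for the members of the family (`GreenTao2010_relativeInverseAt_of_datum`).
[cite: GreenTao2010, Conj. 8.3] -/
def GreenTao2010_inverseDatum (s : ℕ) (δ : ℝ) {m : ℕ} (𝓜 : Fin m → Nilmanifold s) (M c : ℝ) :
    Prop :=
  0 < c ∧ ∀ N : ℕ, 1 ≤ N → ∀ f : ℤ → ℝ, (∀ n, |f n| ≤ 1) →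
    δ ≤ uniformityNorm (s + 1) N (fun n => ((f n : ℝ) : ℂ)) →
      ∃ (i : Fin m) (g : (𝓜 i).G) (x : (𝓜 i).G ⧸ (𝓜 i).Γ) (F : (𝓜 i).G ⧸ (𝓜 i).Γ → ℝ),
        (𝓜 i).IsBoundedLipschitz M F ∧ c ≤ |(𝓜 i).orbitAverage N (fun n => f n) F g x|

/-- **The inverse conjecture for the Gowers norms `GI(s)`** (Green–Tao 2010, Conj. 8.3, as printed:
"Suppose that `0 < δ ≤ 1`. Then there exists a finite collection `ℳ_{s,δ}` of `s`-step
nilmanifolds `G/Γ = (G/Γ, d_{G/Γ})` with the following property. Given any `N` and any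
`f : [N] → [-1,1]` such that `‖f‖_{U^{s+1}[N]} ≥ δ`, there is a nilmanifold `G/Γ ∈ ℳ_{s,δ}` and a
`1`-bounded `s`-step nilsequence `(F(gⁿx))_{n ∈ ℕ}` on it with Lipschitz constant `O_{s,δ}(1)`,
such that `|𝔼_{n ∈ [N]} f(n) F(gⁿ x)| ≫_{s,δ} 1`."), now the inverse theorem of
Green–Tao–Ziegler (2012), Thm. 1.3 (for `s ≥ 3`; `s = 2` is Green–Tao 2008, Prop. 8.4 there;
`s = 1` is classical). This `def` is the printed assertion at level `s` and parameter `δ` — a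
predicate, not a claim (the finite family is indexed by `Fin m`; `O_{s,δ}(1)`, `≫_{s,δ} 1` are the
constants `M`, `c` of `GreenTao2010_inverseDatum`; `f` is read on `[N]` only; nilmanifolds carry
compatible metrics, module docstring of `LinearEquationsInPrimesNilsequences.lean`).
[cite: GreenTao2010, Conj. 8.3] [cite: GreenTaoZiegler2012, Thm. 1.3] -/
def GreenTao2010_inverseConjectureAt (s : ℕ) (δ : ℝ) : Prop :=
  ∃ (m : ℕ) (𝓜 : Fin m → Nilmanifold s) (M c : ℝ), GreenTao2010_inverseDatum s δ 𝓜 M c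

/-- **Nilsequences obstruct uniformity, II** (Green–Tao 2010, Cor. 11.6, as printed: "Let `s ≥ 0`
and `δ ∈ (0,1)`. Let `G/Γ = (G/Γ, d_{G/Γ})` be a nilmanifold with some fixed smooth metric
`d_{G/Γ}`, and let `(F(gⁿx))_{n ∈ ℕ}` be a bounded `s`-step nilsequence with Lipschitz constant at
most `M`. Let `f : [N] → ℝ` be a function for which `𝔼_{n ∈ [N]} |f(n)| ≤ 1` and
`|𝔼_{n ∈ [N]} f(n) F(gⁿ x)| ≥ δ`. Then we have `‖f‖_{U^{s+1}[N]} ≫_{s,δ,M,G/Γ} 1`."; proved in the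
source from the decomposition of nilsequences into averaged ones, Prop. 11.2 and App. E). This
`def` is the printed assertion for the level `s`, the nilmanifold `X` and the Lipschitz bound `M` —
a predicate, not a claim. [cite: GreenTao2010, Cor. 11.6] -/
def GreenTao2010_nilObstructionAt (s : ℕ) (X : Nilmanifold s) (M : ℝ) : Prop :=
  ∀ δ : ℝ, 0 < δ → δ < 1 → ∃ c : ℝ, 0 < c ∧ ∀ N : ℕ, 1 ≤ N →
    ∀ (g : X.G) (x : X.G ⧸ X.Γ) (F : X.G ⧸ X.Γ → ℝ), X.IsBoundedLipschitz M F →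
      ∀ f : ℤ → ℝ, (∑ n ∈ Finset.Icc (1 : ℤ) N, |f n|) / N ≤ 1 →
        δ ≤ |X.orbitAverage N (fun n => f n) F g x| →
          c ≤ uniformityNorm (s + 1) N (fun n => ((f n : ℝ) : ℂ))

/-! ### Bookkeeping on `ℤ_{N'}`: the sets `A`, `I`, the taper of `[N]`, shifts and unwrapping -/

section bookkeeping

variable {N' : ℕ} [NeZero N']

/-- The residues of `{0, …, N-1}`. [folklore] -/
def stepSet (N' N : ℕ) : Finset (ZMod N') := (Finset.range N).image fun j : ℕ => (j : ZMod N')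

/-- The residues of the integer interval `[2 - N, 2N - 1]`. [folklore] -/
def padSet (N' N : ℕ) : Finset (ZMod N') :=
  (Finset.Icc (2 - (N : ℤ)) (2 * N - 1)).image fun j : ℤ => (j : ZMod N')

omit [NeZero N'] in
/-- `|stepSet| = N` for `N ≤ N'`. [folklore] -/
theorem card_stepSet {N : ℕ} (hN : N ≤ N') : (stepSet N' N).card = N := by
  unfold stepSet
  rw [Finset.card_image_of_injOn, Finset.card_range]
  intro a ha b hb hab
  have ha' : a < N' := lt_of_lt_of_le (Finset.mem_range.mp ha) hN
  have hb' : b < N' := lt_of_lt_of_le (Finset.mem_range.mp hb) hN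
  have := (ZMod.natCast_eq_natCast_iff' a b N').mp hab
  rwa [Nat.mod_eq_of_lt ha', Nat.mod_eq_of_lt hb'] at this

omit [NeZero N'] in
/-- The taper condition on `[N]`: `n + (b - a) ∈ [2 - N, 2N - 1]` for `n ∈ [1, N]`,
`a, b ∈ {0, …, N-1}`. [folklore] -/
theorem intCast_add_sub_mem_padSet {N : ℕ} {n : ℤ} (hn1 : 1 ≤ n) (hnN : n ≤ N)
    {a b : ZMod N'} (ha : a ∈ stepSet N' N) (hb : b ∈ stepSet N' N) :
    (n : ZMod N') + (b - a) ∈ padSet N' N := by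
  unfold stepSet at ha hb
  obtain ⟨a', ha', rfl⟩ := Finset.mem_image.mp ha
  obtain ⟨b', hb', rfl⟩ := Finset.mem_image.mp hb
  have ha'' := Finset.mem_range.mp ha'
  have hb'' := Finset.mem_range.mp hb'
  refine Finset.mem_image.mpr ⟨n + b' - a', Finset.mem_Icc.mpr ⟨by omega, by omega⟩, ?_⟩
  push_cast
  ring

omit [NeZero N'] in
/-- Where the taper of `[N]` can be non-zero: `y ∈ [3 - 2N, 3N - 2]` (mod `N'`). [folklore] -/
theorem exists_of_add_sub_mem_padSet {N : ℕ} {y a b : ZMod N'} (ha : a ∈ stepSet N' N)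
    (hb : b ∈ stepSet N' N) (hy : y + (b - a) ∈ padSet N' N) :
    ∃ j : ℤ, 3 - 2 * (N : ℤ) ≤ j ∧ j ≤ 3 * N - 2 ∧ y = (j : ZMod N') := by
  unfold stepSet at ha hb
  unfold padSet at hy
  obtain ⟨a', ha', rfl⟩ := Finset.mem_image.mp ha
  obtain ⟨b', hb', rfl⟩ := Finset.mem_image.mp hb
  obtain ⟨i, hi, hiy⟩ := Finset.mem_image.mp hy
  have ha'' := Finset.mem_range.mp ha'
  have hb'' := Finset.mem_range.mp hb'
  have hi' := Finset.mem_Icc.mp hi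
  refine ⟨i - b' + a', by omega, by omega, ?_⟩
  have : y = (i : ZMod N') - ((b' : ℕ) : ZMod N') + ((a' : ℕ) : ZMod N') := by
    rw [hiy]; ring
  rw [this]
  push_cast
  ring

/-- A function supported on the residues of `[3 - 2N, 3N - 2]`, shifted by `t = 2N - 2`, is
supported on the image of `[1, 5N - 4]` (no wrap-around when `5N - 4 < N'`). [folklore] -/
theorem val_mem_of_shift {N : ℕ} (hN : 1 ≤ N) (hN' : 5 * N - 4 < N') {F : ZMod N' → ℝ}
    (hF : ∀ y, F y ≠ 0 → ∃ j : ℤ, 3 - 2 * (N : ℤ) ≤ j ∧ j ≤ 3 * N - 2 ∧ y = (j : ZMod N'))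
    (y : ZMod N') (hy : F (y - ((2 * N - 2 : ℕ) : ZMod N')) ≠ 0) :
    1 ≤ y.val ∧ y.val ≤ 5 * N - 4 := by
  obtain ⟨j, hj1, hj2, hjy⟩ := hF _ hy
  have hyj : y = ((j + (2 * N - 2 : ℕ) : ℤ) : ZMod N') := by
    rw [Int.cast_add, ← hjy]; push_cast; ring
  have h0 : (0 : ℤ) ≤ j + (2 * N - 2 : ℕ) := by omega
  have hlt : j + (2 * N - 2 : ℕ) < N' := by omega
  have hval : (y.val : ℤ) = j + (2 * N - 2 : ℕ) := by
    rw [hyj, ZMod.val_intCast]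
    exact Int.emod_eq_of_lt h0 hlt
  constructor <;> omega

omit [NeZero N'] in
/-- Unwrapping is linear. [folklore] -/
theorem unwrap_sub (L : ℕ) (F G : ZMod N' → ℝ) (n : ℤ) :
    unwrap N' L (fun y => F y - G y) n = unwrap N' L F n - unwrap N' L G n := by
  unfold unwrap; split_ifs <;> simp

omit [NeZero N'] in
/-- Unwrapping is homogeneous. [folklore] -/
theorem unwrap_const_mul (L : ℕ) (c : ℝ) (F : ZMod N' → ℝ) (n : ℤ) :
    unwrap N' L (fun y => c * F y) n = c * unwrap N' L F n := by
  unfold unwrap; split_ifs <;> simp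

/-- The `ℓ¹` norm of an unwrapping is at most that of the function (`L < N'`: the residues of
`[1, L]` are distinct). [folklore] -/
theorem sum_abs_unwrap_le {L : ℕ} (hL : L < N') (F : ZMod N' → ℝ) :
    ∑ n ∈ Finset.Icc (1 : ℤ) L, |unwrap N' L F n| ≤ ∑ y : ZMod N', |F y| := by
  calc ∑ n ∈ Finset.Icc (1 : ℤ) L, |unwrap N' L F n|
      = ∑ n ∈ Finset.Icc (1 : ℤ) L, |F (n : ZMod N')| := by
        refine Finset.sum_congr rfl fun n hn => ?_
        have h := Finset.mem_Icc.mp hn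
        rw [unwrap_of_mem F h.1 h.2]
    _ = ∑ y ∈ (Finset.Icc (1 : ℤ) L).image (fun n : ℤ => (n : ZMod N')), |F y| := by
        rw [Finset.sum_image]
        intro a ha b hb hab
        have ha' := Finset.mem_Icc.mp ha
        have hb' := Finset.mem_Icc.mp hb
        exact int_eq_of_zmod_eq hab (by rw [abs_lt]; constructor <;> omega)
    _ ≤ ∑ y : ZMod N', |F y| :=
        Finset.sum_le_sum_of_subset_of_nonneg (Finset.subset_univ _) fun y _ _ => abs_nonneg _

/-- Re-indexing the orbit average of the shifted, unwrapped `f 1_{[N]}`: with `t = 2N - 2`,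
`L = 5N - 4` and `w(n) = (f 1_{[N]})(n - t)` on `[1, L]`,
`𝔼_{n ∈ [L]} w(n) F(gⁿ x) = (N/L) 𝔼_{m ∈ [N]} f(m) F(g^m (g^t x))`. [folklore] -/
theorem orbitAverage_unwrap_shift {s : ℕ} (X : Nilmanifold s) {N : ℕ} (hN : 1 ≤ N)
    (hN' : 5 * N - 4 < N') (f : ℤ → ℝ) (F : X.G ⧸ X.Γ → ℝ) (g : X.G) (x : X.G ⧸ X.Γ) :
    X.orbitAverage (5 * N - 4)
        (fun n => unwrap N' (5 * N - 4)
          (fun y => extendByZero N' N f (y - ((2 * N - 2 : ℕ) : ZMod N'))) n) F g x =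
      (N : ℝ) / (5 * N - 4 : ℕ) * X.orbitAverage N (fun n => f n) F g (g ^ (2 * N - 2) • x) := by
  set t : ℕ := 2 * N - 2 with ht
  set L : ℕ := 5 * N - 4 with hL
  have hLpos : (0 : ℝ) < L := by rw [hL]; exact_mod_cast (show 0 < 5 * N - 4 by omega)
  have hNpos : (0 : ℝ) < N := by exact_mod_cast hN
  unfold Nilmanifold.orbitAverage
  rw [div_mul_div_comm, mul_comm (N : ℝ), mul_div_mul_right _ _ hNpos.ne']
  congr 1
  -- the summand vanishes unless `n - t ∈ [1, N]`
  have hterm : ∀ n ∈ Finset.Icc 1 L,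
      unwrap N' L (fun y => extendByZero N' N f (y - (t : ZMod N'))) (n : ℤ) * F (g ^ n • x) =
        if t + 1 ≤ n ∧ n ≤ t + N then f ((n : ℤ) - t) * F (g ^ n • x) else 0 := by
    intro n hn
    have hn' := Finset.mem_Icc.mp hn
    rw [unwrap_of_mem _ (by exact_mod_cast hn'.1) (by exact_mod_cast hn'.2)]
    have hcast : ((n : ℤ) : ZMod N') - (t : ZMod N') = (((n : ℤ) - t : ℤ) : ZMod N') := by
      simp
    rw [hcast]
    by_cases hc : t + 1 ≤ n ∧ n ≤ t + N
    · rw [if_pos hc, extendByZero_intCast (by omega) f (by omega) (by omega)]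
    · rw [if_neg hc]
      have : extendByZero N' N f ((((n : ℤ) - t : ℤ)) : ZMod N') = 0 := by
        by_contra hne
        have hv := extendByZero_ne_zero hne
        have hzv : ((((((n : ℤ) - t : ℤ) : ZMod N')).val : ℤ) : ZMod N') =
            (((n : ℤ) - t : ℤ) : ZMod N') := by
          rw [Int.cast_natCast, ZMod.natCast_zmod_val]
        have heq := int_eq_of_zmod_eq hzv (by rw [abs_lt]; constructor <;> omega)
        omega
      rw [this, zero_mul]
  rw [Finset.sum_congr rfl hterm, ← Finset.sum_filter]
  have hfilt : (Finset.Icc 1 L).filter (fun n => t + 1 ≤ n ∧ n ≤ t + N) = Finset.Icc (t + 1) (t + N) := by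
    ext n
    simp only [Finset.mem_filter, Finset.mem_Icc]
    constructor
    · rintro ⟨_, h⟩; exact h
    · rintro h; exact ⟨⟨by omega, by omega⟩, h⟩
  rw [hfilt, show t + 1 = 1 + t from add_comm _ _, show t + N = N + t from add_comm _ _]
  -- reindex `n = m + t`
  rw [← Finset.map_add_right_Icc (a := 1) (b := N) (c := t), Finset.sum_map]
  refine Finset.sum_congr rfl fun m hm => ?_
  simp only [addRightEmbedding_apply]
  congr 1
  · congr 1; push_cast; ring
  · rw [pow_add, mul_smul]

end bookkeeping

end Literature.NumberTheory.Sieve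

namespace Literature.NumberTheory.Sieve

/-! ### Proposition 10.1 from `GI(s)`, Cor. 11.6 and the Koopman–von Neumann decomposition -/

section relativeinverse

/-- Root extraction: `a^{2^k} ≤ b^{2^k}` with `b ≥ 0` gives `a ≤ b`. [folklore] -/
theorem le_of_pow_two_pow_le {k : ℕ} {a b : ℝ} (hb : 0 ≤ b) (h : a ^ (2 ^ k) ≤ b ^ (2 ^ k)) :
    a ≤ b :=
  le_of_pow_le_pow_left₀ (by positivity) hb h

/-- The contrapositive use of "nilsequences obstruct uniformity, II" in the proof of Prop. 10.1:
a weight `v` of `L¹` size at most `B₁` and `U^{s+1}[L]` norm below `c B₁` has correlation below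
`δ₃ B₁` with the nilsequence. [cite: GreenTao2010, §10 (proof of Prop. 10.1: "from (10.4) and the
contrapositive of Proposition 8.2 we have `|𝔼 f₂(n) F(gⁿx)| = o(1)`") and Cor. 11.6] -/
theorem abs_orbitAverage_lt_of_obstruction {s : ℕ} {X : Nilmanifold s} {M δ₃ c : ℝ}
    (hc : ∀ N : ℕ, 1 ≤ N → ∀ (g : X.G) (x : X.G ⧸ X.Γ) (F : X.G ⧸ X.Γ → ℝ),
      X.IsBoundedLipschitz M F → ∀ f : ℤ → ℝ, (∑ n ∈ Finset.Icc (1 : ℤ) N, |f n|) / N ≤ 1 →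
        δ₃ ≤ |X.orbitAverage N (fun n => f n) F g x| →
          c ≤ uniformityNorm (s + 1) N (fun n => ((f n : ℝ) : ℂ)))
    {L : ℕ} (hL : 1 ≤ L) {B₁ : ℝ} (hB₁ : 0 < B₁) {g : X.G} {x : X.G ⧸ X.Γ} {F : X.G ⧸ X.Γ → ℝ}
    (hF : X.IsBoundedLipschitz M F) {v : ℤ → ℝ}
    (hvL1 : (∑ n ∈ Finset.Icc (1 : ℤ) L, |v n|) / L ≤ B₁)
    (hnormv : uniformityNorm (s + 1) L (fun n => ((v n : ℝ) : ℂ)) < c * B₁) :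
    |X.orbitAverage L (fun n => v n) F g x| < δ₃ * B₁ := by
  by_contra hge
  push Not at hge
  have hL1' : (∑ n ∈ Finset.Icc (1 : ℤ) L, |v n / B₁|) / L ≤ 1 := by
    have : ∑ n ∈ Finset.Icc (1 : ℤ) L, |v n / B₁| = (∑ n ∈ Finset.Icc (1 : ℤ) L, |v n|) / B₁ := by
      rw [Finset.sum_div]
      exact Finset.sum_congr rfl fun n _ => by rw [abs_div, abs_of_pos hB₁]
    rw [this, div_div, mul_comm, ← div_div, div_le_one hB₁]
    exact hvL1
  have hcorr' : δ₃ ≤ |X.orbitAverage L (fun n => v n / B₁) F g x| := by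
    have : (fun n : ℕ => v n / B₁) = fun n : ℕ => B₁⁻¹ * v n := by funext n; ring
    rw [this, Nilmanifold.orbitAverage_const_mul, abs_mul, abs_of_pos (inv_pos.mpr hB₁),
      ← div_le_iff₀' (inv_pos.mpr hB₁), div_inv_eq_mul]
    exact hge
  have h := hc L hL g x F hF (fun n => v n / B₁) hL1' hcorr'
  have hhom : uniformityNorm (s + 1) L (fun n => (((v n / B₁ : ℝ)) : ℂ)) =
      B₁⁻¹ * uniformityNorm (s + 1) L (fun n => ((v n : ℝ) : ℂ)) := by
    rw [← uniformityNorm_ofReal_mul (s + 1) L (inv_pos.mpr hB₁).le]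
    congr 1; funext n; push_cast; ring
  rw [hhom, ← div_eq_inv_mul, le_div_iff₀ hB₁] at h
  linarith

/-- The `L¹` bound for the uniform part `f₂ = (f 1_{[N]} - g)ψ` in the proof of Prop. 10.1: after
shifting and unwrapping to `[1, L]`, `𝔼_{n ∈ [L]} |f₂| ≤ 4C + 1` (from `|f₂| ≤ |f 1_{[N]}| + ψ`,
`|f 1_{[N]}| ≤ ν`, `∑ ν ≤ 2N'`, `ψ ≤ 1` supported on at most `L` residues, `N' ≤ 2CL`).
[cite: GreenTao2010, §10 (proof of Prop. 10.1) and Cor. 11.6 (the hypothesis `𝔼|f| ≤ 1`)] -/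
theorem l1_bound_shift_unwrap {N' : ℕ} [NeZero N'] {L : ℕ} (hL : 1 ≤ L) (hLN' : L < N')
    (F₂ : ZMod N' → ℝ) (t : ZMod N') {ν ψ Ff : ZMod N' → ℝ} (hF₂ : ∀ y, |F₂ y| ≤ |Ff y| + ψ y)
    (hFf : ∀ y, |Ff y| ≤ ν y) (hν : ∑ y, ν y ≤ 2 * N') (hψ1 : ∀ y, ψ y ≤ 1)
    (J : Finset (ZMod N')) (hψJ : ∀ y, ψ y ≠ 0 → y ∈ J) (hJ : J.card ≤ L) {C : ℝ}
    (hN'CL : (N' : ℝ) ≤ 2 * C * L) :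
    (∑ n ∈ Finset.Icc (1 : ℤ) L, |unwrap N' L (fun y => F₂ (y - t)) n|) / L ≤ 4 * C + 1 := by
  have h1 := sum_abs_unwrap_le hLN' (fun y => F₂ (y - t))
  have h2 : ∑ y : ZMod N', |F₂ (y - t)| = ∑ y : ZMod N', |F₂ y| :=
    Fintype.sum_equiv (Equiv.subRight t) _ _ fun y => rfl
  have h3 : ∑ y : ZMod N', |F₂ y| ≤ ∑ y : ZMod N', ν y + ∑ y : ZMod N', ψ y := by
    rw [← Finset.sum_add_distrib]
    exact Finset.sum_le_sum fun y _ => (hF₂ y).trans (add_le_add (hFf y) le_rfl)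
  have h5 : ∑ y : ZMod N', ψ y ≤ L := by
    calc ∑ y : ZMod N', ψ y = ∑ y ∈ J, ψ y := by
          rw [← Finset.sum_subset (Finset.subset_univ J)]
          intro y _ hyJ
          by_contra hne
          exact hyJ (hψJ y hne)
      _ ≤ ∑ _y ∈ J, (1 : ℝ) := Finset.sum_le_sum fun y _ => hψ1 y
      _ = J.card := by rw [Finset.sum_const, nsmul_eq_mul, mul_one]
      _ ≤ L := by exact_mod_cast hJ
  have hLpos : (0 : ℝ) < L := by exact_mod_cast hL
  rw [div_le_iff₀ hLpos]
  have h1' : ∑ n ∈ Finset.Icc (1 : ℤ) L, |unwrap N' L (fun y => F₂ (y - t)) n| ≤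
      ∑ y : ZMod N', |F₂ (y - t)| := h1
  nlinarith

/-- The support of the smoothed model and of the uniform part: both `gψ` and `(f 1_{[N]} - g)ψ`
vanish wherever the taper `ψ` of `[N]` does, i.e. off the residues of `[3 - 2N, 3N - 2]`.
[cite: GreenTao2010, Prop. 10.3 (the support property)] -/
theorem support_of_mul_taper {N' : ℕ} {N : ℕ} {ψ h : ZMod N' → ℝ}
    (hψ : ∀ y, ψ y ≠ 0 → ∃ j : ℤ, 3 - 2 * (N : ℤ) ≤ j ∧ j ≤ 3 * N - 2 ∧ y = (j : ZMod N')) (y : ZMod N')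
    (hy : h y * ψ y ≠ 0) : ∃ j : ℤ, 3 - 2 * (N : ℤ) ≤ j ∧ j ≤ 3 * N - 2 ∧ y = (j : ZMod N') :=
  hψ y fun h0 => hy (by rw [h0, mul_zero])

/-- The parameter `δ / (2 C_B)`, `C_B = 2 (2(s+1))^{s+1} (2C)^{s+2}` (the constant of Lemma B.5 for
`k = s + 1`, `N' ≤ 2CN`), at which `GI(s)` is invoked in the proof of Prop. 10.1.
[cite: GreenTao2010, §10 (proof of Prop. 10.1: "`‖f₁‖_{U^{s+1}} ≫_{C,s} δ`")] -/
def relInvParam (s : ℕ) (C δ : ℝ) : ℝ :=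
  δ / (2 * (2 * (2 * (s + 1 : ℕ)) ^ (s + 1) * (2 * C) ^ (s + 1 + 1)))

/-- `0 < relInvParam s C δ` for `δ, C > 0`. [folklore] -/
theorem relInvParam_pos (s : ℕ) {C δ : ℝ} (hC : 0 < C) (hδ : 0 < δ) : 0 < relInvParam s C δ := by
  unfold relInvParam; positivity

/-- `relInvParam s C δ ≤ 1` for `0 < δ ≤ 1`, `C ≥ 1`. [folklore] -/
theorem relInvParam_le_one (s : ℕ) {C δ : ℝ} (hC : 1 ≤ C) (hδ1 : δ ≤ 1) :
    relInvParam s C δ ≤ 1 := by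
  unfold relInvParam
  have h1 : (1 : ℝ) ≤ (2 * (s + 1 : ℕ)) ^ (s + 1) := one_le_pow₀ (by
    have : (1 : ℝ) ≤ (s + 1 : ℕ) := by exact_mod_cast Nat.succ_pos s
    linarith)
  have h2 : (1 : ℝ) ≤ (2 * C) ^ (s + 1 + 1) := one_le_pow₀ (by linarith)
  rw [div_le_one (by positivity)]
  nlinarith

/-- **Proposition 10.1 of Green–Tao 2010 (the relative inverse Gowers-norm theorem), from `GI(s)`
and "nilsequences obstruct uniformity, II".** For `s ≥ 1`, `0 < δ ≤ 1`, `C ≥ 20` and moment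
constants `A`: given a `GI(s)`-datum at the parameter `relInvParam s C δ = δ/(2C_B)` (a finite family
`𝓜`, Lipschitz bound `M_G`, correlation bound `c_G`; `GreenTao2010_inverseDatum`) each of whose
members satisfies Cor. 11.6 at Lipschitz bound `M_G` (`GreenTao2010_nilObstructionAt`), the
conclusion of Prop. 10.1 at `(s, δ, C, A)` holds as a datum (`GreenTao2010_relativeInverseDatum`,
`LinearEquationsInPrimesNilsequences.lean`) with the same family and Lipschitz bound, `c = c_G / 2`,
threshold `N₀ = 1` and some error `η > 0`. The proof is the printed one (§10, "Proof of
Proposition 10.1"): extend `f` by zero to `ℤ_{N'}` (`‖f 1_{[N]}‖_{U^{s+1}(ℤ_{N'})} ≫_C δ` by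
Lemma B.5), decompose `f 1_{[N]} = f₁ + f₂` by the Koopman–von Neumann theorem with the support
property (`gowers_denseModel` with the taper of `[N]`: `f₁ = gψ` is `1`-bounded and supported on
`[3-2N, 3N-2]`, `‖f₂‖_{U^{s+1}(ℤ_{N'})}` is small), unwrap to the interval `[1, 5N-4]` (Lemma B.5
again), apply `GI(s)` to `f₁` to get a correlating nilsequence from the finite family, bound the
correlation of `f₂` with it by Cor. 11.6 (its `L¹` norm is `O_C(1)` and its `U^{s+1}` norm is
small), and translate back to `[N]`. The threshold `N₀` of the predicate is `1` (so the small-`N`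
torus remark of the source is not needed), and the pseudorandomness error `η` is the `η₀` of
`gowers_denseModel`. [cite: GreenTao2010, Prop. 10.1 and its proof (§10), Lemma B.5, Conj. 8.3,
Cor. 11.6] -/
theorem GreenTao2010_relativeInverseDatum_of_inverseDatum {s : ℕ} (hs : 1 ≤ s) {δ C : ℝ}
    (hδ : 0 < δ) (hC : 20 ≤ C) (A : ℕ → ℝ → ℝ) {m : ℕ} {𝓜 : Fin m → Nilmanifold s} {MG cG : ℝ}
    (hGId : GreenTao2010_inverseDatum s (relInvParam s C δ) 𝓜 MG cG)
    (hNG : ∀ i : Fin m, GreenTao2010_nilObstructionAt s (𝓜 i) MG) :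
    ∃ η : ℝ, GreenTao2010_relativeInverseDatum s δ C A 𝓜 MG (cG / 2) η 1 := by
  classical
  -- parameters
  have hk1 : 1 ≤ s + 1 := by omega
  have hCpos : 0 < C := by linarith
  obtain ⟨CB, hCB⟩ : ∃ CB : ℝ, CB = 2 * (2 * (s + 1 : ℕ)) ^ (s + 1) * (2 * C) ^ (s + 1 + 1) := ⟨_, rfl⟩
  have hCB1 : 1 ≤ CB := by
    rw [hCB]
    have h1 : (1 : ℝ) ≤ (2 * (s + 1 : ℕ)) ^ (s + 1) := one_le_pow₀ (by
      have : (1 : ℝ) ≤ (s + 1 : ℕ) := by exact_mod_cast hk1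
      linarith)
    have h2 : (1 : ℝ) ≤ (2 * C) ^ (s + 1 + 1) := one_le_pow₀ (by linarith)
    nlinarith
  have hCBpos : 0 < CB := by linarith
  obtain ⟨δG, hδG⟩ : ∃ δG : ℝ, δG = δ / (2 * CB) := ⟨_, rfl⟩
  have hδGpos : 0 < δG := by rw [hδG]; positivity
  -- the inverse datum at `δG = relInvParam s C δ`
  have hparam : relInvParam s C δ = δG := by rw [hδG, hCB]; rfl
  rw [hparam] at hGId
  obtain ⟨hcG, HGI⟩ := hGId
  obtain ⟨B₁, hB₁⟩ : ∃ B₁ : ℝ, B₁ = 4 * C + 1 := ⟨_, rfl⟩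
  have hB₁pos : 0 < B₁ := by rw [hB₁]; positivity
  obtain ⟨δ₃, hδ₃⟩ : ∃ δ₃ : ℝ, δ₃ = min (cG / (2 * B₁)) (1 / 2) := ⟨_, rfl⟩
  have hδ₃pos : 0 < δ₃ := by rw [hδ₃]; exact lt_min (by positivity) (by norm_num)
  have hδ₃1 : δ₃ < 1 := by rw [hδ₃]; exact (min_le_right _ _).trans_lt (by norm_num)
  have hδ₃B : δ₃ * B₁ ≤ cG / 2 := by
    have : δ₃ ≤ cG / (2 * B₁) := by rw [hδ₃]; exact min_le_left _ _
    rw [le_div_iff₀ (by positivity)] at this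
    linarith
  -- Cor. 11.6 for each member of the family
  have hNGi : ∀ i : Fin m, ∃ c : ℝ, 0 < c ∧ ∀ N : ℕ, 1 ≤ N →
      ∀ (g : (𝓜 i).G) (x : (𝓜 i).G ⧸ (𝓜 i).Γ) (F : (𝓜 i).G ⧸ (𝓜 i).Γ → ℝ),
        (𝓜 i).IsBoundedLipschitz MG F →
        ∀ f : ℤ → ℝ, (∑ n ∈ Finset.Icc (1 : ℤ) N, |f n|) / N ≤ 1 →
          δ₃ ≤ |(𝓜 i).orbitAverage N (fun n => f n) F g x| →
            c ≤ uniformityNorm (s + 1) N (fun n => ((f n : ℝ) : ℂ)) :=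
    fun i => hNG i δ₃ hδ₃pos hδ₃1
  choose cN hcNpos hcN using hNGi
  obtain ⟨cmin, hcminpos, hcminle⟩ : ∃ cmin : ℝ, 0 < cmin ∧ ∀ i, cmin ≤ cN i := by
    rcases Nat.eq_zero_or_pos m with hm | hm
    · subst hm; exact ⟨1, one_pos, fun i => i.elim0⟩
    · have hne : (Finset.univ : Finset (Fin m)).Nonempty := Finset.univ_nonempty_iff.mpr ⟨⟨0, hm⟩⟩
      obtain ⟨i, _, hi⟩ := Finset.exists_mem_eq_inf' hne cN
      exact ⟨Finset.univ.inf' hne cN, by rw [hi]; exact hcNpos i,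
        fun j => Finset.inf'_le _ (Finset.mem_univ j)⟩
  -- the dense-model accuracy and the pseudorandomness error
  obtain ⟨ε, hε⟩ : ∃ ε : ℝ, ε = min (δG ^ (2 ^ (s + 1))) ((cmin * B₁) ^ (2 ^ (s + 1)) / (2 * CB)) :=
    ⟨_, rfl⟩
  have hεpos : 0 < ε := by rw [hε]; exact lt_min (by positivity) (by positivity)
  obtain ⟨η₀, hη₀pos, hη₀1, HDM⟩ := gowers_denseModel hk1 A (C₀ := 4 * C ^ 2) (by positivity) hεpos
  -- the witnesses
  refine ⟨η₀, half_pos hcG, hη₀pos, ?_⟩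
  intro N hN N' _ hN'p hCN hN'C ν hν f hf hδf
  -- sizes
  have hNpos : (0 : ℝ) < N := by exact_mod_cast hN
  have hN'ge : 20 * (N : ℝ) ≤ N' := le_trans (by nlinarith) hCN
  have hN'ge' : 20 * N ≤ N' := by exact_mod_cast hN'ge
  have hNN' : N < N' := by omega
  have h2N : 2 * N ≤ N' := by omega
  obtain ⟨L, hL⟩ : ∃ L : ℕ, L = 5 * N - 4 := ⟨_, rfl⟩
  obtain ⟨t, ht⟩ : ∃ t : ℕ, t = 2 * N - 2 := ⟨_, rfl⟩
  have hL1 : 1 ≤ L := by omega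
  have hLN : N ≤ L := by omega
  have hLN' : L < N' := by omega
  have h2L : 2 * L ≤ N' := by omega
  have hN'CL : (N' : ℝ) ≤ 2 * C * L := by
    have : (N : ℝ) ≤ L := by exact_mod_cast hLN
    nlinarith
  obtain ⟨hν0, hLFC, hCC⟩ := hν
  have hD1 : 1 ≤ (s + 2) * 2 ^ (s + 1) := Nat.one_le_iff_ne_zero.mpr (by positivity)
  have h2kD : 2 ^ (s + 1) ≤ (s + 2) * 2 ^ (s + 1) := Nat.le_mul_of_pos_left _ (by omega)
  have hk1D : s + 1 + 1 ≤ (s + 2) * 2 ^ (s + 1) :=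
    calc s + 1 + 1 = (s + 2) * 1 := by ring
      _ ≤ (s + 2) * 2 ^ (s + 1) := Nat.mul_le_mul_left _ Nat.one_le_two_pow
  have hEν : (𝔼 x, ν x) ≤ 1 + η₀ := expect_le_of_linearFormsCondition hLFC hD1
  have hsumν : ∑ y : ZMod N', ν y ≤ 2 * N' := by
    have := hEν
    rw [Finset.expect_eq_sum_div_card, Finset.card_univ, ZMod.card,
      div_le_iff₀ (by exact_mod_cast Nat.pos_of_ne_zero (NeZero.ne N'))] at this
    nlinarith [hη₀1, show (0:ℝ) ≤ N' from Nat.cast_nonneg _]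
  -- Step 1: `f 1_{[N]}` on `ℤ_{N'}` and its Gowers norm
  set Ff : ZMod N' → ℝ := extendByZero N' N f with hFf
  have hFfν : ∀ y, |Ff y| ≤ ν y := by
    intro y
    have h := abs_extendByZero_le (N' := N') (N := N) (f := f) (g := fun x : ℤ => ν (x : ZMod N'))
      (fun x hx1 hxN => hf x hx1 hxN) y
    refine h.trans ?_
    unfold extendByZero
    split_ifs
    · show ν (((y.val : ℕ) : ℤ) : ZMod N') ≤ ν y
      rw [Int.cast_natCast, ZMod.natCast_zmod_val]
    · exact hν0 y
  have hFfsupp : ∀ y, Ff y ≠ 0 → 1 ≤ y.val ∧ y.val ≤ N := fun y hy => extendByZero_ne_zero hy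
  have hnormFf : δ / CB ≤ gowersNorm (s + 1) Ff := by
    have h1 : uniformityNorm (s + 1) N (fun n => ((f n : ℝ) : ℂ)) ^ (2 ^ (s + 1)) ≤
        CB * gowersPower (s + 1) Ff := by
      rw [hCB]; exact uniformityNorm_pow_le_gowersPower_extendByZero hk1 hN h2N hN'C f
    have h2 : δ ^ (2 ^ (s + 1)) ≤ uniformityNorm (s + 1) N (fun n => ((f n : ℝ) : ℂ)) ^ (2 ^ (s + 1)) :=
      pow_le_pow_left₀ hδ.le hδf _
    refine le_of_pow_two_pow_le (k := s + 1) (gowersNorm_nonneg hk1 _) ?_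
    rw [gowersNorm_pow hk1, div_pow]
    have hCBpow : CB ≤ CB ^ (2 ^ (s + 1)) := by
      calc CB = CB ^ 1 := (pow_one _).symm
        _ ≤ CB ^ (2 ^ (s + 1)) := pow_le_pow_right₀ hCB1 Nat.one_le_two_pow
    calc δ ^ (2 ^ (s + 1)) / CB ^ (2 ^ (s + 1)) ≤ δ ^ (2 ^ (s + 1)) / CB :=
          div_le_div_of_nonneg_left (by positivity) hCBpos hCBpow
      _ ≤ CB * gowersPower (s + 1) Ff / CB := div_le_div_of_nonneg_right (h2.trans h1) hCBpos.le
      _ = gowersPower (s + 1) Ff := by field_simp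
  -- Step 2: the taper of `[N]`
  set i₁ : Fin (s + 1) := ⟨0, by omega⟩ with hi₁
  set i₂ : Fin (s + 1) := ⟨1, by omega⟩ with hi₂
  have hne : i₁ ≠ i₂ := by rw [hi₁, hi₂]; simp
  have hAcard : (stepSet N' N).card = N := card_stepSet hNN'.le
  have hApos : 0 < (stepSet N' N).card := by rw [hAcard]; omega
  set θ : ℝ := ((N' : ℝ) / (stepSet N' N).card) ^ 2 with hθ
  have hθ0 : 0 ≤ θ := sq_nonneg _
  have hθC : θ ≤ 4 * C ^ 2 := by
    rw [hθ, hAcard]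
    have : (N' : ℝ) / N ≤ 2 * C := by rw [div_le_iff₀ hNpos]; linarith
    have h0 : 0 ≤ (N' : ℝ) / N := by positivity
    nlinarith
  set ψ : ZMod N' → ℝ := taper i₁ i₂ (padSet N' N) (stepSet N' N) with hψdef
  have hψθ : ∀ y, ψ y = θ * gdual (s + 1) (taperFamily i₁ i₂ (padSet N' N) (stepSet N' N)) y :=
    fun y => rfl
  have hψmem : ∀ y, 0 ≤ ψ y ∧ ψ y ≤ 1 := fun y => taper_mem hne _ _ y
  have hψone : ∀ y, Ff y ≠ 0 → ψ y = 1 := by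
    intro y hy
    obtain ⟨hv1, hvN⟩ := hFfsupp y hy
    have hyv : y = (((y.val : ℕ) : ℤ) : ZMod N') := by rw [Int.cast_natCast, ZMod.natCast_zmod_val]
    refine taper_eq_one hne hApos fun a ha b hb => ?_
    rw [hyv]
    exact intCast_add_sub_mem_padSet (by exact_mod_cast hv1) (by exact_mod_cast hvN) ha hb
  have hψsupp : ∀ y, ψ y ≠ 0 → ∃ j : ℤ, 3 - 2 * (N : ℤ) ≤ j ∧ j ≤ 3 * N - 2 ∧ y = (j : ZMod N') := by
    intro y hy
    obtain ⟨a, ha, b, hb, hab⟩ := exists_of_taper_ne_zero hne hy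
    exact exists_of_add_sub_mem_padSet ha hb hab
  -- Step 3: the Koopman–von Neumann decomposition
  obtain ⟨g, hg1, -, hgp⟩ := HDM N' ((s + 2) * 2 ^ (s + 1)) h2kD hk1D η₀ ν hη₀pos.le le_rfl
    ⟨hν0, hLFC, hCC⟩ (taperFamily i₁ i₂ (padSet N' N) (stepSet N' N)) θ
    (fun ω x => abs_taperFamily_le i₁ i₂ _ _ ω x) hθ0 hθC
    (fun y => (hψθ y) ▸ (hψmem y).1) (fun y => (hψθ y) ▸ (hψmem y).2) Ff hFfν
  set g₁ : ZMod N' → ℝ := fun y => g y * ψ y with hg₁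
  set f₂ : ZMod N' → ℝ := fun y => (Ff y - g y) * ψ y with hf₂
  have hdecomp : ∀ y, Ff y = g₁ y + f₂ y := by
    intro y
    show Ff y = g y * ψ y + (Ff y - g y) * ψ y
    by_cases hy : Ff y = 0
    · rw [hy]; ring
    · rw [hψone y hy]; ring
  have hgpf₂ : gowersPower (s + 1) f₂ ≤ ε := hgp
  have hg₁bd : ∀ y, |g₁ y| ≤ 1 := by
    intro y
    show |g y * ψ y| ≤ 1
    rw [abs_mul, abs_of_nonneg (hψmem y).1]
    exact mul_le_one₀ (hg1 y) (hψmem y).1 (hψmem y).2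
  have hg₁supp : ∀ y, g₁ y ≠ 0 → ∃ j : ℤ, 3 - 2 * (N : ℤ) ≤ j ∧ j ≤ 3 * N - 2 ∧ y = (j : ZMod N') :=
    fun y hy => support_of_mul_taper hψsupp y hy
  have hf₂supp : ∀ y, f₂ y ≠ 0 → ∃ j : ℤ, 3 - 2 * (N : ℤ) ≤ j ∧ j ≤ 3 * N - 2 ∧ y = (j : ZMod N') :=
    fun y hy => support_of_mul_taper (h := fun z => Ff z - g z) hψsupp y hy
  have hf₂abs : ∀ y, |f₂ y| ≤ |Ff y| + ψ y := by
    intro y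
    show |(Ff y - g y) * ψ y| ≤ |Ff y| + ψ y
    rw [sub_mul]
    refine (abs_sub _ _).trans (add_le_add ?_ ?_)
    · rw [abs_mul, abs_of_nonneg (hψmem y).1]
      exact mul_le_of_le_one_right (abs_nonneg _) (hψmem y).2
    · rw [abs_mul, abs_of_nonneg (hψmem y).1]
      exact mul_le_of_le_one_left (hψmem y).1 (hg1 y)
  -- `‖g₁‖_{U^{s+1}(ℤ_{N'})} ≥ δ/CB - ε^{1/2^{s+1}} ≥ δG`
  have hnormf₂ : gowersNorm (s + 1) f₂ ≤ δG := by
    refine le_of_pow_two_pow_le (k := s + 1) hδGpos.le ?_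
    rw [gowersNorm_pow hk1]
    exact hgpf₂.trans (by rw [hε]; exact min_le_left _ _)
  have hnormg₁ : δG ≤ gowersNorm (s + 1) g₁ := by
    have htri := gowersNorm_add_le hk1 g₁ f₂
    have heq : (fun y => g₁ y + f₂ y) = Ff := by funext y; rw [hdecomp y]
    rw [heq] at htri
    have : δ / CB = 2 * δG := by rw [hδG]; field_simp
    linarith
  -- Step 4: shift by `t` and unwrap to `[1, L]`
  set g₁' : ZMod N' → ℝ := fun y => g₁ (y - (t : ZMod N')) with hg₁'
  set f₂' : ZMod N' → ℝ := fun y => f₂ (y - (t : ZMod N')) with hf₂'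
  have hgpg₁' : gowersPower (s + 1) g₁' = gowersPower (s + 1) g₁ := by
    have : g₁' = fun y => g₁ (y + -(t : ZMod N')) := by
      funext y; show g₁ (y - (t : ZMod N')) = _; rw [sub_eq_add_neg]
    rw [this]; exact gowersPower_comp_add (s + 1) g₁ _
  have hgpf₂' : gowersPower (s + 1) f₂' = gowersPower (s + 1) f₂ := by
    have : f₂' = fun y => f₂ (y + -(t : ZMod N')) := by
      funext y; show f₂ (y - (t : ZMod N')) = _; rw [sub_eq_add_neg]
    rw [this]; exact gowersPower_comp_add (s + 1) f₂ _
  have hg₁'supp : ∀ y, g₁' y ≠ 0 → 1 ≤ y.val ∧ y.val ≤ L := fun y hy => by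
    rw [hL]; exact val_mem_of_shift hN (hL ▸ hLN') hg₁supp y (ht ▸ hy)
  have hf₂'supp : ∀ y, f₂' y ≠ 0 → 1 ≤ y.val ∧ y.val ≤ L := fun y hy => by
    rw [hL]; exact val_mem_of_shift hN (hL ▸ hLN') hf₂supp y (ht ▸ hy)
  set u : ℤ → ℝ := unwrap N' L g₁' with hu
  set v : ℤ → ℝ := unwrap N' L f₂' with hv
  set w : ℤ → ℝ := unwrap N' L (fun y => Ff (y - (t : ZMod N'))) with hw
  have hubd : ∀ n, |u n| ≤ 1 := fun n => (abs_unwrap_le g₁' n).trans (hg₁bd _)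
  have huwv : ∀ n, u n = w n - v n := by
    intro n
    rw [hu, hv, hw, ← unwrap_sub]
    congr 1
    funext y
    show g₁ (y - (t : ZMod N')) = Ff (y - (t : ZMod N')) - f₂ (y - (t : ZMod N'))
    linarith [hdecomp (y - (t : ZMod N'))]
  -- `‖u‖_{U^{s+1}[L]} ≥ ‖g₁‖_{U^{s+1}(ℤ_{N'})} ≥ δG`
  have hnormu : δG ≤ uniformityNorm (s + 1) L (fun n => ((u n : ℝ) : ℂ)) := by
    have h1 := gowersPower_extendByZero_le (k := s + 1) hL1 h2L u
    have hext : extendByZero N' L u = g₁' := extendByZero_unwrap hg₁'supp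
    rw [hext, hgpg₁'] at h1
    refine le_of_pow_two_pow_le (k := s + 1) (uniformityNorm_nonneg _ _ _) (le_trans ?_ h1)
    rw [← gowersNorm_pow hk1]
    exact pow_le_pow_left₀ hδGpos.le hnormg₁ _
  -- Step 5: apply `GI(s)` on `[1, L]`
  obtain ⟨i, g₀, x₀, F, hFL, hcorr⟩ := HGI L hL1 u hubd hnormu
  -- Step 6: the correlation of `v` is small, by Cor. 11.6
  have hvL1 : (∑ n ∈ Finset.Icc (1 : ℤ) L, |v n|) / L ≤ B₁ := by
    rw [hB₁, hv, hf₂']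
    refine l1_bound_shift_unwrap hL1 hLN' f₂ (t : ZMod N') hf₂abs hFfν hsumν (fun y => (hψmem y).2)
      ((Finset.Icc (3 - 2 * (N : ℤ)) (3 * N - 2)).image (fun j : ℤ => (j : ZMod N'))) ?_ ?_ hN'CL
    · intro y hy
      obtain ⟨j, hj1, hj2, rfl⟩ := hψsupp y hy
      exact Finset.mem_image.mpr ⟨j, Finset.mem_Icc.mpr ⟨hj1, hj2⟩, rfl⟩
    · refine Finset.card_image_le.trans ?_
      rw [Int.card_Icc, hL]
      omega
  have hnormv : uniformityNorm (s + 1) L (fun n => ((v n : ℝ) : ℂ)) < cmin * B₁ := by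
    have h1 := uniformityNorm_pow_le_gowersPower_extendByZero hk1 hL1 h2L hN'CL v
    have hext : extendByZero N' L v = f₂' := extendByZero_unwrap hf₂'supp
    rw [hext, hgpf₂', ← hCB] at h1
    have h2 : CB * gowersPower (s + 1) f₂ < (cmin * B₁) ^ (2 ^ (s + 1)) := by
      have : gowersPower (s + 1) f₂ ≤ (cmin * B₁) ^ (2 ^ (s + 1)) / (2 * CB) :=
        hgpf₂.trans (by rw [hε]; exact min_le_right _ _)
      calc CB * gowersPower (s + 1) f₂ ≤ CB * ((cmin * B₁) ^ (2 ^ (s + 1)) / (2 * CB)) :=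
            mul_le_mul_of_nonneg_left this hCBpos.le
        _ = (cmin * B₁) ^ (2 ^ (s + 1)) / 2 := by field_simp
        _ < (cmin * B₁) ^ (2 ^ (s + 1)) := by linarith [pow_pos (mul_pos hcminpos hB₁pos) (2 ^ (s + 1))]
    exact lt_of_pow_lt_pow_left₀ _ (by positivity) (h1.trans_lt h2)
  have hcorrv : |(𝓜 i).orbitAverage L (fun n => v n) F g₀ x₀| < cG / 2 :=
    (abs_orbitAverage_lt_of_obstruction (hcN i) hL1 hB₁pos hFL hvL1
      (hnormv.trans_le (mul_le_mul_of_nonneg_right (hcminle i) hB₁pos.le))).trans_le hδ₃B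
  -- Step 7: the correlation of `w`, and back to `[N]`
  have hcorrw : cG / 2 ≤ |(𝓜 i).orbitAverage L (fun n => w n) F g₀ x₀| := by
    have hsplit : (𝓜 i).orbitAverage L (fun n => u n) F g₀ x₀ =
        (𝓜 i).orbitAverage L (fun n => w n) F g₀ x₀ - (𝓜 i).orbitAverage L (fun n => v n) F g₀ x₀ := by
      rw [← Nilmanifold.orbitAverage_sub]
      congr 1; funext n; exact huwv n
    rw [hsplit] at hcorr
    linarith [abs_sub ((𝓜 i).orbitAverage L (fun n => w n) F g₀ x₀)
      ((𝓜 i).orbitAverage L (fun n => v n) F g₀ x₀)]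
  have hreidx := orbitAverage_unwrap_shift (N' := N') (𝓜 i) hN (hL ▸ hLN') f F g₀ x₀
  rw [← hL, ← ht] at hreidx
  refine ⟨i, g₀, g₀ ^ t • x₀, F, hFL, ?_⟩
  have hratio : (N : ℝ) / L ≤ 1 := by
    rw [div_le_one (by exact_mod_cast hL1)]; exact_mod_cast hLN
  have hratio0 : 0 < (N : ℝ) / L := by positivity
  have hw' : (fun n : ℕ => w n) = fun n : ℕ =>
      unwrap N' L (fun y => extendByZero N' N f (y - ((t : ℕ) : ZMod N'))) n := rfl
  rw [hw', hreidx, abs_mul, abs_of_pos hratio0] at hcorrw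
  calc cG / 2 ≤ (N : ℝ) / L * |(𝓜 i).orbitAverage N (fun n => f n) F g₀ (g₀ ^ t • x₀)| := hcorrw
    _ ≤ 1 * |(𝓜 i).orbitAverage N (fun n => f n) F g₀ (g₀ ^ t • x₀)| :=
        mul_le_mul_of_nonneg_right hratio (abs_nonneg _)
    _ = |(𝓜 i).orbitAverage N (fun n => f n) F g₀ (g₀ ^ t • x₀)| := one_mul _

/-- **Prop. 10.1 from a `GI(s)`-datum and Cor. 11.6 for its members**, as the predicate
`GreenTao2010_relativeInverseAt s δ C A` (the family and Lipschitz bound being those of the datum,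
`GreenTao2010_relativeInverseDatum_of_inverseDatum`). [cite: GreenTao2010, Prop. 10.1] -/
theorem GreenTao2010_relativeInverseAt_of_datum {s : ℕ} (hs : 1 ≤ s) {δ C : ℝ} (hδ : 0 < δ)
    (hC : 20 ≤ C) (A : ℕ → ℝ → ℝ) {m : ℕ} {𝓜 : Fin m → Nilmanifold s} {MG cG : ℝ}
    (hGId : GreenTao2010_inverseDatum s (relInvParam s C δ) 𝓜 MG cG)
    (hNG : ∀ i : Fin m, GreenTao2010_nilObstructionAt s (𝓜 i) MG) :
    GreenTao2010_relativeInverseAt s δ C A := by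
  obtain ⟨η, hd⟩ := GreenTao2010_relativeInverseDatum_of_inverseDatum hs hδ hC A hGId hNG
  exact ⟨m, 𝓜, MG, cG / 2, η, 1, hd⟩

/-- **Prop. 10.1 from `GI(s)` and Cor. 11.6** (the unbundled form): if `GI(s)` holds at every
parameter in `(0,1]` and Cor. 11.6 holds for every `s`-step nilmanifold and Lipschitz bound, then
`GreenTao2010_relativeInverseAt s δ C A` for all `0 < δ ≤ 1`, `C ≥ 20`, `A`.
[cite: GreenTao2010, Prop. 10.1, Conj. 8.3, Cor. 11.6] -/
theorem GreenTao2010_relativeInverseAt_of {s : ℕ} (hs : 1 ≤ s) {δ C : ℝ} (hδ : 0 < δ) (hδ1 : δ ≤ 1)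
    (hC : 20 ≤ C) (A : ℕ → ℝ → ℝ)
    (hGI : ∀ δ' : ℝ, 0 < δ' → δ' ≤ 1 → GreenTao2010_inverseConjectureAt s δ')
    (hNG : ∀ (X : Nilmanifold s) (M : ℝ), GreenTao2010_nilObstructionAt s X M) :
    GreenTao2010_relativeInverseAt s δ C A := by
  obtain ⟨m, 𝓜, MG, cG, hd⟩ := hGI (relInvParam s C δ) (relInvParam_pos s (by linarith) hδ)
    (relInvParam_le_one s (by linarith) hδ1)
  exact GreenTao2010_relativeInverseAt_of_datum hs hδ hC A hd fun i => hNG (𝓜 i) MG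

end relativeinverse

end Literature.NumberTheory.Sieve

namespace Literature.NumberTheory.Sieve

/-! ### Theorem 7.2 from `GI(s)`, Cor. 11.6 and Prop. 10.2 -/

/-- **Thm. 7.2 (all `s`) from `GI(s)`, "nilsequences obstruct uniformity, II" and Prop. 10.2**
(Green–Tao 2010, §10: "In view of Proposition 10.1 and Proposition 6.4 … Theorem 7.2 … follows
from [Prop. 10.2]", with Prop. 10.1 now proved from `GI(s)` and Cor. 11.6, Prop. 6.4 proved in the
tree): the Gowers uniformity of the `W`-tricked primes follows from the three nilsequence-side
statements at every level `s ≥ 1`. [cite: GreenTao2010, Thm. 7.2, §10, Conj. 8.3, Cor. 11.6,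
Prop. 10.2] -/
theorem GreenTao2010_gowersUniformity_of_conjectures
    (hGI : ∀ s : ℕ, 1 ≤ s → ∀ δ : ℝ, 0 < δ → δ ≤ 1 → GreenTao2010_inverseConjectureAt s δ)
    (hNG : ∀ s : ℕ, 1 ≤ s → ∀ (X : Nilmanifold s) (M : ℝ), GreenTao2010_nilObstructionAt s X M)
    (h102 : ∀ s : ℕ, 1 ≤ s → ∀ (X : Nilmanifold s) (M : ℝ),
      GreenTao2010_nilsequenceOrthogonalityAt s X M) :
    GreenTao2010_gowersUniformity :=
  GreenTao2010_gowersUniformity_of_relativeInverse_of_orthogonality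
    (fun s hs _δ hδ hδ1 _C hC A => GreenTao2010_relativeInverseAt_of hs hδ hδ1 hC A (hGI s hs) (hNG s hs))
    h102

/-- **The Green–Tao–Ziegler theorem from `GI(s)`, Cor. 11.6 and Prop. 10.2** (all other
ingredients of Green–Tao 2010 being proved in the tree). [cite: GreenTao2010, Main Theorem and
§10] [cite: GreenTaoZiegler2012, Thm. 1.3 and the following paragraph] -/
theorem GreenTaoZiegler2012_finiteComplexity_of_conjectures
    (hGI : ∀ s : ℕ, 1 ≤ s → ∀ δ : ℝ, 0 < δ → δ ≤ 1 → GreenTao2010_inverseConjectureAt s δ)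
    (hNG : ∀ s : ℕ, 1 ≤ s → ∀ (X : Nilmanifold s) (M : ℝ), GreenTao2010_nilObstructionAt s X M)
    (h102 : ∀ s : ℕ, 1 ≤ s → ∀ (X : Nilmanifold s) (M : ℝ),
      GreenTao2010_nilsequenceOrthogonalityAt s X M) :
    GreenTaoZiegler2012_finiteComplexity :=
  GreenTaoZiegler2012_finiteComplexity_of_gowersUniformity
    (GreenTao2010_gowersUniformity_of_conjectures hGI hNG h102)

end Literature.NumberTheory.Sieve
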